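import Summits.BirchSwinnertonDyer.BirchSwinnertonDyer.Theorems.UniversalToricDescentLocalTermClosedForm
import Summits.BirchSwinnertonDyer.Rank1Residual.X2.LocalDeltaCalculus
import HarnessLib

/-!
# Route UniversalToricDescent — over `ℚ`, the local term IS Greenberg–Vatsal's `d_ℓ`:
# `#H¹(kerD κ v, E[p^∞])[p] = p^{d_ℓ}`, `d_ℓ = dMultiplicity E p v` (multiplicity of `ℓ̃⁻¹` as a root of `P̃_ℓ`)

Lead prover bsd-wall-utd-p1 g10 (`--supports stmt-BirchSwinnertonDyer-20399`; bridge between the UTD lane's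
closed form of the Greenberg–Vatsal Prop. (2.4) local term (`UniversalToricDescentLocalTermClosedForm`, by
reduction type and `(a_v, q_v) mod p`) and the X2 cell's LITERAL transcription of Greenberg–Vatsal's
`d_ℓ` (`Literature.…GreenbergVatsal2000.dMultiplicity W p v := rootMultiplicity ℓ̃⁻¹ (P̃_ℓ)`, with its
reduction-type calculus `X2.LocalDeltaCalculus`). For `E/ℚ`, ANY `ℤ_p`-extension `κ` of `ℚ`, and a place
`v = (ℓ)`, `ℓ ≠ p`, finitely decomposed in `κ` (`D_v ⊄ ker κ`; automatic for the cyclotomic `κ`):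

* `natCard_pTorsion_subgroupH1_kerD_eq_pow_dMultiplicity` —
  **`#{f ∈ H¹(kerD κ v, E[p^∞]) : p • f = 0} = p ^ dMultiplicity E p v`**,

i.e. the `s_v` of the kernel's Σ-transport identities is `d_ℓ` ON THE NOSE — Greenberg–Vatsal's
"`𝓗_ℓ(ℚ_∞) ≅ (ℚ_p/ℤ_p)^{s_ℓ d_ℓ}`" read one prime of `ℚ_∞` at a time on the `p`-torsion (the factor `s_ℓ` =
number of primes of `ℚ_∞` above `ℓ` is the kernel's `3^{c_v}`/`p^{c_v}` place count). Assembly by the local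
trichotomy: additive (`P̃ = 1`, both sides `0`), split / non-split multiplicative (`P̃ = 1 ∓ X`,
`[ℓ ≡ ±1]`), good (`P̃ = 1 − ãX + ℓ̃X²`: `0` iff `p ∤ ℓ + 1 − a_ℓ`, else `1 + [ℓ ≡ 1]`).

THEOREMS ONLY; no definition, no named fact, no `sorry`. BSD is not advanced by this file.
References: [GreenbergVatsal2000] §2 Prop. (2.4) (p. 22) and p. 27; [GreenbergLNM1716] §3 Lemma 3.3.
-/

set_option autoImplicit false
-- `…BirchSwinnertonDyer.BirchSwinnertonDyer.Theorems…` is the problem's mandated namespace (D-0017).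
set_option linter.dupNamespace false

noncomputable section

open scoped Classical

namespace Summit.BirchSwinnertonDyer.BirchSwinnertonDyer.Theorems.UniversalToricDescentLocalTermClosedForm

open Function NumberField IsDedekindDomain Field WeierstrassCurve
open Literature.NumberTheory.EllipticCurves Literature.NumberTheory.EllipticCurves.GreenbergSelmer
  Literature.NumberTheory.EllipticCurves.GreenbergVatsal2000 IsDedekindDomain.HeightOneSpectrum
  Summit.BirchSwinnertonDyer.Rank1Residual.X11b Summit.BirchSwinnertonDyer.Rank1Residual.X11b.Coinv
  Summit.BirchSwinnertonDyer.Rank1Residual.Iwasawa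
  Summit.BirchSwinnertonDyer.Rank1Residual.X2.LocalDeltaCalculus

variable (W : WeierstrassCurve ℚ) [W.IsElliptic] {p : ℕ} [hp : Fact p.Prime] (κ : ZpExtension ℚ p)
  {v : HeightOneSpectrum (𝓞 ℚ)}

/-- `(ℓ : 𝔽_p) = (c : 𝔽_p) ↔ p ∣ c − ℓ` for a natural number `ℓ` and an integer `c`. [folklore] -/
private theorem natCast_eq_intCast_iff (ℓ : ℕ) (c : ℤ) :
    ((ℓ : ZMod p) = (c : ZMod p)) ↔ (p : ℤ) ∣ c - ℓ := by
  rw [← Int.cast_natCast, ZMod.intCast_eq_intCast_iff_dvd_sub]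

/-- **Over `ℚ` the local term of Greenberg–Vatsal's Prop. (2.4) is `d_ℓ` on the nose**: for `E/ℚ`, a
`ℤ_p`-extension `κ` of `ℚ`, and a place `v = (ℓ)` with `ℓ ≠ p` finitely decomposed in `κ`,
`#{f ∈ H¹(kerD κ v, E[p^∞]) : p • f = 0} = p ^ dMultiplicity E p v`, where `dMultiplicity E p v` is the
multiplicity of `ℓ̃⁻¹` as a root of the Euler factor `P̃_ℓ(X) mod p` (the X2 cell's transcription of GV's
`d_ℓ`). [cite: GreenbergVatsal2000, §2 Prop. (2.4) (p. 22) and p. 27] [cite: GreenbergLNM1716, §3 Lemma 3.3] -/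
theorem natCard_pTorsion_subgroupH1_kerD_eq_pow_dMultiplicity (hpv : (p : 𝓞 ℚ) ∉ v.asIdeal)
    (hD : ¬ (decomp v ≤ κ.kerSubgroup)) :
    Nat.card {f : Literature.NumberTheory.EllipticCurves.subgroupH1 (kerD κ v)
        (W.geomPrimaryTorsion p) // p • f = 0} = p ^ dMultiplicity W p v := by
  -- `ℓ ≠ p` and `q_v = ℓ`
  set ℓ : ℕ := Rat.HeightOneSpectrum.natGenerator v with hℓdef
  have hℓmem : ((ℓ : ℕ) : 𝓞 ℚ) ∈ v.asIdeal := by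
    have h := (Rat.HeightOneSpectrum.natGenerator_dvd_iff v).mp dvd_rfl
    rwa [← map_natCast (Rat.IsIntegralClosure.intEquiv (𝓞 ℚ)), Ideal.apply_mem_of_equiv_iff] at h
  have hℓ : Rat.HeightOneSpectrum.natGenerator v ≠ p := fun h ↦ hpv (by rw [← h]; exact hℓmem)
  rw [natCard_pTorsion_subgroupH1_kerD_eq_pow_ite W κ hpv hD, natCard_residueField_eq_natGenerator v]
  congr 1
  rcases hasGoodReductionAt_or_hasMultiplicativeReductionAt_or_hasAdditiveReductionAt v W with
    hg | hm | ha
  · -- good reduction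
    rw [if_pos hg]
    by_cases hdvd : (p : ℤ) ∣ (Rat.HeightOneSpectrum.natGenerator v + 1 - W.frobeniusTraceAt v : ℤ)
    · rw [if_pos hdvd, dMultiplicity_of_hasGoodReductionAt_of_dvd hg hℓ hdvd]
      by_cases h1 : (p : ℤ) ∣ (Rat.HeightOneSpectrum.natGenerator v : ℤ) - 1
      · rw [if_pos h1, if_pos ((natCast_eq_intCast_iff _ 1).mpr (by rwa [dvd_sub_comm]) |>.trans
          (by push_cast; rfl))]
      · rw [if_neg h1, if_neg (fun h ↦ h1 ?_)]
        rw [dvd_sub_comm]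
        exact (natCast_eq_intCast_iff _ 1).mp (h.trans (by push_cast; rfl))
    · rw [if_neg hdvd, (dMultiplicity_eq_zero_iff_of_hasGoodReductionAt hg hℓ).mpr hdvd]
  · -- multiplicative reduction
    rw [if_neg hm.not_hasGoodReductionAt]
    by_cases hs : W.HasSplitMultiplicativeReductionAt v
    · rw [if_pos hs, dMultiplicity_of_hasSplitMultiplicativeReductionAt hs]
      by_cases h1 : (p : ℤ) ∣ 1 - (Rat.HeightOneSpectrum.natGenerator v : ℤ)
      · rw [if_pos h1, if_pos (((natCast_eq_intCast_iff _ 1).mpr h1).trans (by push_cast; rfl))]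
      · rw [if_neg h1, if_neg (fun h ↦ h1 ((natCast_eq_intCast_iff _ 1).mp (h.trans (by push_cast; rfl))))]
    · rw [if_neg hs, if_pos hm, dMultiplicity_of_hasNonsplitMultiplicativeReductionAt hm hs]
      by_cases h1 : (p : ℤ) ∣ -1 - (Rat.HeightOneSpectrum.natGenerator v : ℤ)
      · rw [if_pos h1, if_pos (((natCast_eq_intCast_iff _ (-1)).mpr h1).trans (by push_cast; rfl))]
      · rw [if_neg h1,
          if_neg (fun h ↦ h1 ((natCast_eq_intCast_iff _ (-1)).mp (h.trans (by push_cast; rfl))))]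
  · -- additive reduction
    have hng : ¬ W.HasGoodReductionAt v := ha.not_hasGoodReductionAt
    have hnm : ¬ W.HasMultiplicativeReductionAt v := fun h ↦ h.not_hasAdditiveReductionAt ha
    have hns : ¬ W.HasSplitMultiplicativeReductionAt v := fun h ↦ hnm h.hasMultiplicativeReductionAt
    rw [if_neg hng, if_neg hns, if_neg hnm, dMultiplicity_of_hasAdditiveReductionAt ha]

end Summit.BirchSwinnertonDyer.BirchSwinnertonDyer.Theorems.UniversalToricDescentLocalTermClosedForm

end
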